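import Summits.BirchSwinnertonDyer.BirchSwinnertonDyer.Theorems.EisensteinPrimesMazurMCOnCellBTwistbackZigzagClassData
import HarnessLib

/-!
# Crux 3 `MazurMCOnCellB` (stmt-BirchSwinnertonDyer-19033), line `twistback` v10 — ZIG-ZAG COMPONENTS LIVE IN THE EVEN
# TWIST FAMILY: every vertex connected to `W` is a model of an even quadratic twist `W^{(D)}`, `D > 0`, `p ∤ D`

Width seat bsd-line-x2-p1-w3 (gen 15), cell `bsd-eis`, 2026-08-28; lane F2e (sequel of F2d p674224 `…ZigzagClassData`).
`--supports stmt-BirchSwinnertonDyer-19033 --as helper`. HONEST FRAMING: THEOREMS ONLY (no `def`, no named fact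
introduced, no `sorry`), fact-free except `hmodN` (modularity, for the conductor of an isogenous curve) where marked; closes
no registered stub; no summit statement, no Mazur main conjecture and no case of BSD is proved for any curve; 0 cells /
labels / stubs / tiers move.

## What

The registered kernel stub 6⁵ `stub_upperPartnerOffSubrowNoConnectedClassShaUnit` (twistback v10, LEAD g14, RESHAPE #32)
excludes the X2b pairs `(W, p)` whose isogeny class is CONNECTED, along zig-zags of certified two-step edges `TwoStepAt p`
(x2-p1-w6 g3 p667979; relation of w3 g14 p671590 inline), to a Ш-unit class. This file pins down WHERE such a class can
sit: in the even quadratic-twist family of `W`'s class, prime to `p`.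

* §1 `TwoStepAt.exists_smul_eq_quadraticTwist_pos_symm` — an edge is a MUTUAL even twist prime to `p` (the start is a
  model of `W″^{(D)}` with the same `D = d_K d_{K″} > 0`, `p ∤ D`; square-twist identity, p669353
  `exists_smul_eq_quadraticTwist_symm`).
* §2 `exists_smul_eq_quadraticTwist_pos_of_zigzag` — **along any zig-zag `W ⇝ U`, `U` is a model of `W^{(D)}` with
  `D > 0`, `p ∤ D`** (induction; twists compose through models, `exists_smul_eq_quadraticTwist_mul`); corollaries
  `gvPar_iff_of_zigzag` (the Greenberg–Vatsal type is constant on components — even twists unramified at `p`,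
  Greenberg–Vatsal's remark after Thm. (1.3)) and `j_eq_of_zigzag` (components stay in ONE `ℚ̄`-isomorphism class).
* §3 `exists_evenTwist_classShaUnit_of_exists_connectedClassShaUnit` — **the datum of 6⁵ at `W` yields `W₁ ∼ W`,
  `D > 0` with `p ∤ D`, a globally minimal model `U` of `W₁^{(D)}` and a Ш-unit curve `Uc ∼ U`**; with `hmodN` the start
  member is `W` itself (`…_of_exists_connectedClassShaUnit'`, via p674224 `exists_connectedClassShaUnit_iff`); and the
  contrapositive `not_exists_connectedClassShaUnit_of_forall_evenTwist` in the stub's polarity: if NO even twist of `W`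
  prime to `p` has a globally minimal model isogenous to a curve with `p`-unit `#Ш_an`, the third hypothesis of 6⁵ holds
  at `W`. NET: the class-wide supply the line owes («one Ш-unit vertex per component», LEAD g14 verdict) is a statement
  about the EVEN ADMISSIBLE TWIST FAMILY of each X2b class and nothing else (idea-12's `UnitAnchorSupply` shape).

References: p667979, p671590, p672105, p674224; LEAD g14 v10 / verdict g14 §2; Silverman, *AEC* X.2 Prop. 2.4, X.5
Cor. 5.4.1 [SilvermanAEC2009]; Greenberg–Vatsal, Invent. Math. 142 (2000), remark after Thm. (1.3) [GreenbergVatsal2000].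
-/

set_option autoImplicit false
set_option linter.dupNamespace false -- `Summit.BirchSwinnertonDyer.BirchSwinnertonDyer.…`: summit = sub-problem name

noncomputable section

open scoped Classical

open WeierstrassCurve NumberField
  Literature.NumberTheory.EllipticCurves
  Literature.NumberTheory.EllipticCurves.ModularForms
  Literature.NumberTheory.QuadraticFields
  Literature.NumberTheory.EllipticCurves.Rank1Residual
  Literature.NumberTheory.EllipticCurves.Rank1Residual.Typed
  Summit.BirchSwinnertonDyer.Rank1Residual
  Summit.BirchSwinnertonDyer.BirchSwinnertonDyer.Theorems.EisensteinPrimesMazurMCOnCellBTwistbackTwoStepDefs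
  Summit.BirchSwinnertonDyer.BirchSwinnertonDyer.Theorems.EisensteinPrimesMazurMCOnCellBTwistbackDefectSwapUp
  Summit.BirchSwinnertonDyer.BirchSwinnertonDyer.Theorems.EisensteinPrimesMazurMCOnCellBTwistbackZigzagClassData

namespace Summit.BirchSwinnertonDyer.BirchSwinnertonDyer.Theorems.EisensteinPrimesMazurMCOnCellBTwistbackZigzagTwistFamily

/-! ## §1. An edge is a mutual even twist prime to `p` -/

/-- **The START of an edge is a model of an even twist of its far end, prime to `p`**: if `TwoStepAt p W W″` then
`C • W = W″^{(D)}` for some `D > 0` with `p ∤ D` (the same `D = d_K · d_{K″}` as in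
`TwoStepAt.exists_smul_eq_quadraticTwist_pos`, turned around by the square-twist identity
`exists_smul_eq_quadraticTwist_symm`). Bookkeeping. [folklore] -/
theorem TwoStepAt.exists_smul_eq_quadraticTwist_pos_symm {p : ℕ} [Fact p.Prime] {W W'' : WeierstrassCurve ℚ}
    (hp2 : p ≠ 2) (h : TwoStepAt p W W'') :
    ∃ (D : ℤ), 0 < D ∧ ¬ (p : ℤ) ∣ D ∧ ∃ C : VariableChange ℚ, C • W = W''.quadraticTwist ((D : ℤ) : ℚ) := by
  obtain ⟨D, hD, hpD, C, hC⟩ := h.exists_smul_eq_quadraticTwist_pos hp2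
  have hD0 : ((D : ℤ) : ℚ) ≠ 0 := by exact_mod_cast hD.ne'
  obtain ⟨C', hC'⟩ := exists_smul_eq_quadraticTwist_symm W W'' hD0 hC
  exact ⟨D, hD, hpD, C', hC'⟩

/-! ## §2. Along a zig-zag every vertex is a model of an even twist of the start, prime to `p` -/

/-- **Zig-zag components live in the even twist family.** If `W ⇝ U` along the zig-zag relation of twistback v10
(forward edges `TwoStepAt p A B`, backward edges `TwoStepAt p B A` carrying the X2b assertion of `B`), then
`C • U = W^{(D)}` for some `D > 0` with `p ∤ D`: the empty path is the twist by `1`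
(`exists_variableChange_quadraticTwist_one`); a forward step multiplies `D` by `d_K d_{K″}`
(`TwoStepAt.exists_smul_eq_quadraticTwist_pos`), a backward step too (§1), and twists compose through models
(`exists_smul_eq_quadraticTwist_mul`). `p` odd. Fact-free. [folklore] -/
theorem exists_smul_eq_quadraticTwist_pos_of_zigzag {p : ℕ} [Fact p.Prime] (hp2 : p ≠ 2) {W U : WeierstrassCurve ℚ}
    (h : Relation.ReflTransGen (fun A B : WeierstrassCurve ℚ ↦ TwoStepAt p A B ∨
      (TwoStepAt p B A ∧ ∃ (_ : B.IsElliptic) (_ : B.IsGloballyMinimal), X2.CellB B p)) W U) :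
    ∃ (D : ℤ), 0 < D ∧ ¬ (p : ℤ) ∣ D ∧ ∃ C : VariableChange ℚ, C • U = W.quadraticTwist ((D : ℤ) : ℚ) := by
  have hp : Prime (p : ℤ) := Nat.prime_iff_prime_int.mp Fact.out
  induction h with
  | refl =>
    obtain ⟨C, hC⟩ := W.exists_variableChange_quadraticTwist_one
    exact ⟨1, one_pos, hp.not_dvd_one, C, by rw [hC]; push_cast; rfl⟩
  | @tail V U' _ hVU ih =>
    obtain ⟨D, hD, hpD, C, hC⟩ := ih
    have hstep : ∃ (D' : ℤ), 0 < D' ∧ ¬ (p : ℤ) ∣ D' ∧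
        ∃ C' : VariableChange ℚ, C' • U' = V.quadraticTwist ((D' : ℤ) : ℚ) := by
      rcases hVU with hVU | ⟨hUV, -, -, -⟩
      · exact hVU.exists_smul_eq_quadraticTwist_pos hp2
      · exact TwoStepAt.exists_smul_eq_quadraticTwist_pos_symm hp2 hUV
    obtain ⟨D', hD', hpD', C', hC'⟩ := hstep
    obtain ⟨C₂, hC₂⟩ := exists_smul_eq_quadraticTwist_mul hC hC'
    refine ⟨D * D', mul_pos hD hD', fun hdvd ↦ ?_, C₂, by rw [hC₂]; push_cast; rfl⟩
    rcases hp.dvd_or_dvd hdvd with h1 | h1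
    exacts [hpD h1, hpD' h1]

/-- **The Greenberg–Vatsal type is constant on zig-zag components**: along `W ⇝ U`, `GVPar U p ↔ GVPar W p` — `U` is a
model of an even twist of `W` unramified at `p` (§2) and such twists preserve the type (`gvPar_twist_iff_of_pos`,
Greenberg–Vatsal's remark after Thm. (1.3)). Fact-free. [cite: GreenbergVatsal2000, remark after Thm. (1.3)] -/
theorem gvPar_iff_of_zigzag {p : ℕ} [Fact p.Prime] (hp2 : p ≠ 2) {W U : WeierstrassCurve ℚ} [W.IsElliptic]
    [U.IsElliptic]
    (h : Relation.ReflTransGen (fun A B : WeierstrassCurve ℚ ↦ TwoStepAt p A B ∨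
      (TwoStepAt p B A ∧ ∃ (_ : B.IsElliptic) (_ : B.IsGloballyMinimal), X2.CellB B p)) W U) :
    GVPar U p ↔ GVPar W p := by
  obtain ⟨D, hD, hpD, C, hC⟩ := exists_smul_eq_quadraticTwist_pos_of_zigzag hp2 h
  exact gvPar_twist_iff_of_pos hp2 hD hpD C hC

/-- **Components stay in one `ℚ̄`-isomorphism class**: along `W ⇝ U`, `j(U) = j(W)` (§2: `U ≅ W^{(D)}` over `ℚ` up to a
change of variables; `variableChange_j`, `j_quadraticTwist`). Fact-free. [folklore] -/
theorem j_eq_of_zigzag {p : ℕ} [Fact p.Prime] (hp2 : p ≠ 2) {W U : WeierstrassCurve ℚ} [W.IsElliptic] [U.IsElliptic]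
    (h : Relation.ReflTransGen (fun A B : WeierstrassCurve ℚ ↦ TwoStepAt p A B ∨
      (TwoStepAt p B A ∧ ∃ (_ : B.IsElliptic) (_ : B.IsGloballyMinimal), X2.CellB B p)) W U) :
    U.j = W.j := by
  obtain ⟨D, hD, -, C, hC⟩ := exists_smul_eq_quadraticTwist_pos_of_zigzag hp2 h
  have hD0 : ((D : ℤ) : ℚ) ≠ 0 := by exact_mod_cast hD.ne'
  haveI := W.isElliptic_quadraticTwist hD0
  have key : ∀ (X Y : WeierstrassCurve ℚ) [X.IsElliptic] [Y.IsElliptic], X = Y → X.j = Y.j := by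
    rintro X Y _ _ rfl; rfl
  rw [← variableChange_j U C, key _ _ hC, j_quadraticTwist W hD0]

/-! ## §3. The Ш-unit class of the 6⁵ datum is the class of an even twist prime to `p` -/

/-- **The datum of stub 6⁵ at `W` yields an even twist with a Ш-unit class**: from «`∃ W₁ ∼ W`, a zig-zag `W₁ ⇝ U`,
`U ∼ Uc`, `#Ш_an(Uc)` a rational `p`-unit» (VERBATIM the negated third hypothesis of
`stub_upperPartnerOffSubrowNoConnectedClassShaUnit`) one gets `W₁ ∼ W`, `D > 0` with `p ∤ D`, a globally minimal model `U`
of `W₁^{(D)}` and a Ш-unit curve `Uc ∼ U` (§2 on the zig-zag). `p` odd. Fact-free. [folklore] -/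
theorem exists_evenTwist_classShaUnit_of_exists_connectedClassShaUnit {p : ℕ} [Fact p.Prime] (hp2 : p ≠ 2)
    {W : WeierstrassCurve ℚ}
    (h : ∃ (W₁ : WeierstrassCurve ℚ) (_ : W₁.IsElliptic) (_ : W₁.IsGloballyMinimal)
        (W'' : WeierstrassCurve ℚ) (_ : W''.IsElliptic) (_ : W''.IsGloballyMinimal)
        (Wc : WeierstrassCurve ℚ) (_ : Wc.IsElliptic) (_ : Wc.IsGloballyMinimal),
        IsIsogenous W W₁ ∧
        Relation.ReflTransGen (fun A B : WeierstrassCurve ℚ ↦ TwoStepAt p A B ∨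
          (TwoStepAt p B A ∧ ∃ (_ : B.IsElliptic) (_ : B.IsGloballyMinimal), X2.CellB B p)) W₁ W'' ∧
        IsIsogenous W'' Wc ∧ ∃ q : ℚ, shaAn Wc = (q : ℂ) ∧ padicValRat p q = 0) :
    ∃ (W₁ : WeierstrassCurve ℚ) (_ : W₁.IsElliptic) (_ : W₁.IsGloballyMinimal) (D : ℤ)
      (U : WeierstrassCurve ℚ) (_ : U.IsElliptic) (_ : U.IsGloballyMinimal)
      (Uc : WeierstrassCurve ℚ) (_ : Uc.IsElliptic) (_ : Uc.IsGloballyMinimal),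
      IsIsogenous W W₁ ∧ 0 < D ∧ ¬ (p : ℤ) ∣ D ∧
      (∃ C : VariableChange ℚ, C • U = W₁.quadraticTwist ((D : ℤ) : ℚ)) ∧
      IsIsogenous U Uc ∧ ∃ q : ℚ, shaAn Uc = (q : ℂ) ∧ padicValRat p q = 0 := by
  obtain ⟨W₁, _, _, U, _, _, Uc, _, _, h₁, hz, hc, hu⟩ := h
  obtain ⟨D, hD, hpD, hC⟩ := exists_smul_eq_quadraticTwist_pos_of_zigzag hp2 hz
  exact ⟨W₁, inferInstance, inferInstance, D, U, inferInstance, inferInstance, Uc, inferInstance, inferInstance, h₁, hD,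
    hpD, hC, hc, hu⟩

/-- **The same with the start member `W` itself** (granted modularity): at a globally minimal elliptic `W`, the 6⁵ datum
yields `D > 0` with `p ∤ D`, a globally minimal model `U` of `W^{(D)}` — an EVEN QUADRATIC TWIST OF `W` PRIME TO `p` —
and a Ш-unit curve `Uc ∼ U` (p674224 `exists_connectedClassShaUnit_iff` removes `W₁`, then §2). Conditional on `hmodN`
only. [folklore] -/
theorem exists_evenTwist_classShaUnit_of_exists_connectedClassShaUnit' (hmodN : nonempty_modularParametrizationData)
    {p : ℕ} [Fact p.Prime] (hp2 : p ≠ 2) (W : WeierstrassCurve ℚ) [W.IsElliptic] [W.IsGloballyMinimal]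
    (h : ∃ (W₁ : WeierstrassCurve ℚ) (_ : W₁.IsElliptic) (_ : W₁.IsGloballyMinimal)
        (W'' : WeierstrassCurve ℚ) (_ : W''.IsElliptic) (_ : W''.IsGloballyMinimal)
        (Wc : WeierstrassCurve ℚ) (_ : Wc.IsElliptic) (_ : Wc.IsGloballyMinimal),
        IsIsogenous W W₁ ∧
        Relation.ReflTransGen (fun A B : WeierstrassCurve ℚ ↦ TwoStepAt p A B ∨
          (TwoStepAt p B A ∧ ∃ (_ : B.IsElliptic) (_ : B.IsGloballyMinimal), X2.CellB B p)) W₁ W'' ∧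
        IsIsogenous W'' Wc ∧ ∃ q : ℚ, shaAn Wc = (q : ℂ) ∧ padicValRat p q = 0) :
    ∃ (D : ℤ) (U : WeierstrassCurve ℚ) (_ : U.IsElliptic) (_ : U.IsGloballyMinimal)
      (Uc : WeierstrassCurve ℚ) (_ : Uc.IsElliptic) (_ : Uc.IsGloballyMinimal),
      0 < D ∧ ¬ (p : ℤ) ∣ D ∧ (∃ C : VariableChange ℚ, C • U = W.quadraticTwist ((D : ℤ) : ℚ)) ∧
      IsIsogenous U Uc ∧ ∃ q : ℚ, shaAn Uc = (q : ℂ) ∧ padicValRat p q = 0 := by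
  obtain ⟨U, _, _, Uc, _, _, hz, hc, hu⟩ := (exists_connectedClassShaUnit_iff hmodN W).mp h
  obtain ⟨D, hD, hpD, hC⟩ := exists_smul_eq_quadraticTwist_pos_of_zigzag hp2 hz
  exact ⟨D, U, inferInstance, inferInstance, Uc, inferInstance, inferInstance, hD, hpD, hC, hc, hu⟩

/-- **Contrapositive, in the stub's polarity**: if NO even quadratic twist `W^{(D)}` (`D > 0`, `p ∤ D`) has a globally
minimal model `U` isogenous over `ℚ` to a globally minimal curve with `p`-unit `#Ш_an`, then the third hypothesis of
`stub_upperPartnerOffSubrowNoConnectedClassShaUnit` HOLDS at `(W, p)` (no Ш-unit class is connected to the class of `W`).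
So the population on which 6⁵ is still asked contains every X2b pair whose even admissible twist family, read class-wide,
carries no `p`-unit `#Ш_an` — the complement of idea-12's supply statement. Conditional on `hmodN` only. [folklore] -/
theorem not_exists_connectedClassShaUnit_of_forall_evenTwist (hmodN : nonempty_modularParametrizationData)
    {p : ℕ} [Fact p.Prime] (hp2 : p ≠ 2) (W : WeierstrassCurve ℚ) [W.IsElliptic] [W.IsGloballyMinimal]
    (hno : ∀ (D : ℤ) (U : WeierstrassCurve ℚ) [U.IsElliptic] [U.IsGloballyMinimal]
      (Uc : WeierstrassCurve ℚ) [Uc.IsElliptic] [Uc.IsGloballyMinimal],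
      0 < D → ¬ (p : ℤ) ∣ D → (∃ C : VariableChange ℚ, C • U = W.quadraticTwist ((D : ℤ) : ℚ)) →
      IsIsogenous U Uc → ¬ ∃ q : ℚ, shaAn Uc = (q : ℂ) ∧ padicValRat p q = 0) :
    ¬ ∃ (W₁ : WeierstrassCurve ℚ) (_ : W₁.IsElliptic) (_ : W₁.IsGloballyMinimal)
        (W'' : WeierstrassCurve ℚ) (_ : W''.IsElliptic) (_ : W''.IsGloballyMinimal)
        (Wc : WeierstrassCurve ℚ) (_ : Wc.IsElliptic) (_ : Wc.IsGloballyMinimal),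
        IsIsogenous W W₁ ∧
        Relation.ReflTransGen (fun A B : WeierstrassCurve ℚ ↦ TwoStepAt p A B ∨
          (TwoStepAt p B A ∧ ∃ (_ : B.IsElliptic) (_ : B.IsGloballyMinimal), X2.CellB B p)) W₁ W'' ∧
        IsIsogenous W'' Wc ∧ ∃ q : ℚ, shaAn Wc = (q : ℂ) ∧ padicValRat p q = 0 := by
  intro h
  obtain ⟨D, U, _, _, Uc, _, _, hD, hpD, hC, hc, hu⟩ :=
    exists_evenTwist_classShaUnit_of_exists_connectedClassShaUnit' hmodN hp2 W h
  exact hno D U Uc hD hpD hC hc hu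

end Summit.BirchSwinnertonDyer.BirchSwinnertonDyer.Theorems.EisensteinPrimesMazurMCOnCellBTwistbackZigzagTwistFamily

end
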